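import Summits.Parity.GeneralizedHardyLittlewood.Theses.LiouvilleShiftedTables
import Summits.Parity.GeneralizedHardyLittlewood.Theorems.TableChowla.Negative.TableChowlaEquivalentForms

/-!
# `TableChowla` (stmt-Parity-14270), line `corner-local-box`: why `stub_corner` resists cheap refutation

Support lemma for the crux `LiouvilleShiftedTables.TableChowla` (drefute seat on line `corner-local-box`):
`stubCorner_of_uniformBlockChowla : UniformBlockChowla → ⟨registered signature of stub_corner, verbatim⟩`
(= `CornerChowlaStub` of the companion file `CornerStubLoadBearing.lean` by `Iff.rfl`). The line's
load-bearing stub follows from uniform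
Chowla–Elliott with a log-power rate for the four linear forms `b ↦ ab+c, a'b+c, a(b+k)+c, a'(b+k)+c`
of a 2×2 block of the shifted table (`UniformBlockChowla`: standard-shaped, believed, open — the 4-point
cousin of `UniformBinaryChowla` of `TableChowlaOfUniformBinaryChowla`), by summing the row bound at
exponent `K + 1` over the `≤ 2A` rows of a corner. Consequently the stub sits between `UniformBlockChowla`
and the crux (`TableChowla_of` of the line file), and a disproof of it in substance would refute uniform
4-point Chowla–Elliott for `λ`: there is no cheap kill, only the degenerate ones of the companion file
`CornerStubLoadBearing.lean` (`c = 0`, an axis, a pretender). [folklore]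
-/

namespace Summit.Parity.GeneralizedHardyLittlewood.Theorems.TableChowla.Negative

open Finset Real ArithmeticFunction

noncomputable section

/-! ## Rows of a corner and the uniform block hypothesis -/

/-- One row of a corner: the 4-point correlation of `f` along the four linear forms
`b ↦ ab+c, a'b+c, a(b+k)+c, a'(b+k)+c` of a 2×2 block with rows `a, a'` and column gap `k`. -/
def blockRow (f : ℕ → ℝ) (c : ℤ) (a a' k N : ℕ) : ℝ :=
  ∑ b ∈ Icc 1 N, f (Int.toNat ((a : ℤ) * b + c)) * f (Int.toNat ((a' : ℤ) * b + c)) *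
    f (Int.toNat ((a : ℤ) * ((b : ℤ) + k) + c)) * f (Int.toNat ((a' : ℤ) * ((b : ℤ) + k) + c))

/-- The corner sum of `stub_corner` (verbatim shape) is the sum of its rows. -/
theorem stubCornerSum_eq_sum_blockRow (c : ℤ) (h k A₁ A₂ B : ℕ) :
    (∑ a ∈ Finset.Ioc A₁ (A₂ - h), ∑ b ∈ Finset.Icc 1 (B - k),
      (ArithmeticFunction.liouville (Int.toNat ((a : ℤ) * b + c)) : ℝ) *
        (ArithmeticFunction.liouville (Int.toNat (((a : ℤ) + h) * b + c)) : ℝ) *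
        (ArithmeticFunction.liouville (Int.toNat ((a : ℤ) * ((b : ℤ) + k) + c)) : ℝ) *
        (ArithmeticFunction.liouville (Int.toNat (((a : ℤ) + h) * ((b : ℤ) + k) + c)) : ℝ)) =
      ∑ a ∈ Ioc A₁ (A₂ - h), blockRow lam c a (a + h) k (B - k) := by
  unfold blockRow lam
  refine sum_congr rfl fun a _ => sum_congr rfl fun b _ => ?_
  simp only [Nat.cast_add]

/-- HYPOTHESIS — uniform Chowla–Elliott with a log-power rate for the four linear forms of a 2×2
block (standard-shaped, believed, open; the 4-point cousin of `UniformBinaryChowla`): for `c ≠ 0` and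
every `C`, beyond some `x₀(c, C)`, uniformly for distinct rows `a ≠ a'` up to `x`, column gaps
`1 ≤ k ≤ x` and lengths `x^{1/2} ≤ N ≤ x`:
`|Σ_{b ≤ N} λ(ab+c)λ(a'b+c)λ(a(b+k)+c)λ(a'(b+k)+c)| ≤ N/(log x)^C`.
Of the four forms at most one pair can be proportional (iff `a a' k = ±(a' − a) c`; the product is
then a non-degenerate 2-point correlation), and none once `a a' k ≥ (a + a')|c|`. -/
def UniformBlockChowla : Prop :=
  ∀ c : ℤ, c ≠ 0 → ∀ C : ℝ, 0 < C → ∃ x₀ : ℝ, ∀ x : ℝ, x₀ ≤ x → ∀ a a' k N : ℕ, a ≠ a' → 1 ≤ k →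
    (a : ℝ) ≤ x → (a' : ℝ) ≤ x → (k : ℝ) ≤ x → x ^ ((1 : ℝ) / 2) ≤ N → (N : ℝ) ≤ x →
      |blockRow lam c a a' k N| ≤ N / Real.log x ^ C

/-- **RESISTANCE THEOREM for `stub_corner`**: `UniformBlockChowla ⟹ stub_corner` (verbatim signature) — sum the row
bound at exponent `K + 1` over the `≤ 2A` rows of the corner (`N = ⌊x/A⌋ − k ≥ x^{7/12} − 1 − x^{1/12}/4
≥ x^{1/2}` once `x ≥ 2¹²`; `2A·(x/A)/(log x)^{K+1} ≤ x/(log x)^K` once `log x ≥ 2`). Hence any disproof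
of the stub in substance disproves uniform 4-point Chowla–Elliott for `λ`. -/
theorem stubCorner_of_uniformBlockChowla (hU : UniformBlockChowla) :
    ∀ c : ℤ, c ≠ 0 → ∀ δ : ℝ, 0 < δ → δ ≤ 1 / 12 → ∀ K : ℝ, 0 < K → ∃ x₀ : ℝ,
    ∀ x : ℝ, x₀ ≤ x → ∀ A : ℝ, x ^ δ ≤ A → A ≤ x ^ (1 / 3 + δ) → ∀ h k : ℕ, 1 ≤ h →
      (h : ℝ) ≤ Real.log x ^ K → 1 ≤ k → (k : ℝ) ≤ Real.log x ^ K →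
        |∑ a ∈ Finset.Ioc ⌊A⌋₊ (⌊2 * A⌋₊ - h), ∑ b ∈ Finset.Icc 1 (⌊x / A⌋₊ - k),
          (ArithmeticFunction.liouville (Int.toNat ((a : ℤ) * b + c)) : ℝ) *
            (ArithmeticFunction.liouville (Int.toNat (((a : ℤ) + h) * b + c)) : ℝ) *
            (ArithmeticFunction.liouville (Int.toNat ((a : ℤ) * ((b : ℤ) + k) + c)) : ℝ) *
            (ArithmeticFunction.liouville (Int.toNat (((a : ℤ) + h) * ((b : ℤ) + k) + c)) : ℝ)| ≤
          x / Real.log x ^ K := by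
  intro c hc δ hδ hδ' K hK
  obtain ⟨x₁, hx₁⟩ := hU c hc (K + 1) (by linarith)
  obtain ⟨X, hX⟩ := eventually_log_rpow_le hδ K
  refine ⟨max x₁ (max X ((2 : ℝ) ^ (12 : ℕ))), fun x hx A hA hA' h k hh hhK hk hkK => ?_⟩
  have hxx₁ : x₁ ≤ x := le_trans (le_max_left _ _) hx
  have hxX : X ≤ x := le_trans (le_trans (le_max_left _ _) (le_max_right _ _)) hx
  have hx4096 : (2 : ℝ) ^ (12 : ℕ) ≤ x := le_trans (le_trans (le_max_right _ _) (le_max_right _ _)) hx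
  have hx1 : (1 : ℝ) ≤ x := le_trans (by norm_num) hx4096
  have hxpos : 0 < x := by linarith
  obtain ⟨h4, hlog2⟩ := hX x hxX
  have hlogpos : 0 < Real.log x := by linarith
  have hL0 : Real.log x ≠ 0 := hlogpos.ne'
  have hLK : 0 < Real.log x ^ K := Real.rpow_pos_of_pos hlogpos K
  have hLK1 : 0 < Real.log x ^ (K + 1) := Real.rpow_pos_of_pos hlogpos (K + 1)
  have hLK0 : Real.log x ^ K ≠ 0 := hLK.ne'
  -- u = x^{1/12} ≥ 2 and the powers of u
  set u : ℝ := x ^ ((1 : ℝ) / 12) with hu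
  have hu0 : 0 ≤ u := Real.rpow_nonneg hxpos.le _
  have hu2 : 2 ≤ u := by
    have hmono : ((2 : ℝ) ^ (12 : ℕ)) ^ ((1 : ℝ) / 12) ≤ x ^ ((1 : ℝ) / 12) :=
      Real.rpow_le_rpow (by positivity) hx4096 (by norm_num)
    have htwo : ((2 : ℝ) ^ (12 : ℕ)) ^ ((1 : ℝ) / 12) = 2 := by
      rw [← Real.rpow_natCast (2 : ℝ) 12, ← Real.rpow_mul (by norm_num : (0 : ℝ) ≤ 2)]
      norm_num
    rw [htwo] at hmono
    exact hmono
  have hu1 : 1 ≤ u := by linarith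
  have hux : u ^ (12 : ℕ) = x := by
    rw [hu, ← Real.rpow_natCast, ← Real.rpow_mul hxpos.le]
    norm_num
  have hx712 : x ^ ((7 : ℝ) / 12) = u ^ (7 : ℕ) := by
    rw [hu, ← Real.rpow_natCast, ← Real.rpow_mul hxpos.le]
    norm_num
  have hx512 : x ^ ((5 : ℝ) / 12) = u ^ (5 : ℕ) := by
    rw [hu, ← Real.rpow_natCast, ← Real.rpow_mul hxpos.le]
    norm_num
  have hx12 : x ^ ((1 : ℝ) / 2) = u ^ (6 : ℕ) := by
    rw [hu, ← Real.rpow_natCast, ← Real.rpow_mul hxpos.le]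
    norm_num
  have hu6 : (64 : ℝ) ≤ u ^ (6 : ℕ) := by
    have := pow_le_pow_left₀ (by norm_num : (0 : ℝ) ≤ 2) hu2 6
    norm_num at this
    exact this
  have hu6' : u ≤ u ^ (6 : ℕ) := le_self_pow₀ hu1 (by norm_num)
  have hu7 : 2 * u ^ (6 : ℕ) ≤ u ^ (7 : ℕ) := by
    have := mul_le_mul_of_nonneg_left hu2 (by positivity : (0 : ℝ) ≤ u ^ (6 : ℕ))
    calc 2 * u ^ (6 : ℕ) = u ^ (6 : ℕ) * 2 := by ring
      _ ≤ u ^ (6 : ℕ) * u := this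
      _ = u ^ (7 : ℕ) := by ring
  have hu12 : 2 * u ^ (5 : ℕ) ≤ u ^ (12 : ℕ) := by
    have h7 : (2 : ℝ) ≤ u ^ (7 : ℕ) := le_trans hu2 (le_self_pow₀ hu1 (by norm_num))
    calc 2 * u ^ (5 : ℕ) ≤ u ^ (7 : ℕ) * u ^ (5 : ℕ) := mul_le_mul_of_nonneg_right h7 (by positivity)
      _ = u ^ (12 : ℕ) := by ring
  have huux : u ≤ x := by rw [← hux]; exact le_self_pow₀ hu1 (by norm_num)
  -- the window
  have hA1 : 1 ≤ A := le_trans (Real.one_le_rpow hx1 hδ.le) hA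
  have hApos : 0 < A := by linarith
  have hA0 : A ≠ 0 := hApos.ne'
  have hA512 : A ≤ x ^ ((5 : ℝ) / 12) := hA'.trans (Real.rpow_le_rpow_of_exponent_le hx1 (by linarith))
  have h2A : 2 * A ≤ x := by rw [hx512] at hA512; rw [← hux]; linarith
  have hxA : u ^ (7 : ℕ) ≤ x / A := by
    rw [← hx712, le_div_iff₀ hApos]
    calc x ^ ((7 : ℝ) / 12) * A ≤ x ^ ((7 : ℝ) / 12) * x ^ ((5 : ℝ) / 12) :=
          mul_le_mul_of_nonneg_left hA512 (Real.rpow_nonneg hxpos.le _)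
      _ = x := by rw [← Real.rpow_add hxpos]; norm_num
  -- the gaps: h, k ≤ (log x)^K ≤ x^δ/4 ≤ u/4
  have hxδ : x ^ δ ≤ u := by rw [hu]; exact Real.rpow_le_rpow_of_exponent_le hx1 hδ'
  have hkr : (k : ℝ) ≤ u / 4 := by linarith
  have hkx : (k : ℝ) ≤ x := by linarith
  -- the columns N = ⌊x/A⌋ − k
  rw [stubCornerSum_eq_sum_blockRow]
  set Bn : ℕ := ⌊x / A⌋₊ with hBn
  set N : ℕ := Bn - k with hN
  have hBle : (Bn : ℝ) ≤ x / A := Nat.floor_le (by positivity)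
  have hBge : x / A - 1 < Bn := by
    have := Nat.lt_floor_add_one (x / A)
    rw [← hBn] at this
    linarith
  have hNk : (Bn : ℝ) ≤ (N : ℝ) + k := by exact_mod_cast le_tsub_add
  have hNlow : x ^ ((1 : ℝ) / 2) ≤ N := by
    rw [hx12]
    have h1 : u ^ (7 : ℕ) - 1 - u / 4 ≤ N := by linarith
    linarith
  have hNBn : (N : ℝ) ≤ Bn := by exact_mod_cast Nat.sub_le Bn k
  have hNxA : (N : ℝ) ≤ x / A := hNBn.trans hBle
  have hNle : (N : ℝ) ≤ x := hNxA.trans (div_le_self hxpos.le hA1)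
  -- each row is a 4-point block correlation covered by the hypothesis at exponent K + 1
  have h2Afl : (⌊2 * A⌋₊ : ℝ) ≤ 2 * A := Nat.floor_le (by linarith)
  have hrow : ∀ a ∈ Ioc ⌊A⌋₊ (⌊2 * A⌋₊ - h), |blockRow lam c a (a + h) k N| ≤ (N : ℝ) / Real.log x ^ (K + 1) := by
    intro a ha
    rw [mem_Ioc] at ha
    have ha2 : a ≤ ⌊2 * A⌋₊ := by omega
    have hah : a + h ≤ ⌊2 * A⌋₊ := by omega
    have ha_le : (a : ℝ) ≤ x := by
      have : ((a : ℕ) : ℝ) ≤ ((⌊2 * A⌋₊ : ℕ) : ℝ) := by exact_mod_cast ha2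
      linarith
    have hah_le : ((a + h : ℕ) : ℝ) ≤ x := by
      have : ((a + h : ℕ) : ℝ) ≤ ((⌊2 * A⌋₊ : ℕ) : ℝ) := by exact_mod_cast hah
      linarith
    exact hx₁ x hxx₁ a (a + h) k N (by omega) hk ha_le hah_le hkx hNlow hNle
  -- the number of rows is at most 2A
  have hrows : ((⌊2 * A⌋₊ - h - ⌊A⌋₊ : ℕ) : ℝ) ≤ 2 * A := by
    have h1 : ((⌊2 * A⌋₊ - h - ⌊A⌋₊ : ℕ) : ℝ) ≤ ((⌊2 * A⌋₊ - ⌊A⌋₊ : ℕ) : ℝ) := by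
      exact_mod_cast (by omega : ⌊2 * A⌋₊ - h - ⌊A⌋₊ ≤ ⌊2 * A⌋₊ - ⌊A⌋₊)
    have h2 : ((⌊2 * A⌋₊ - ⌊A⌋₊ : ℕ) : ℝ) ≤ 2 * A := by
      rw [Nat.cast_sub (Nat.floor_le_floor (by linarith : A ≤ 2 * A))]
      have h3 : A - 1 < (⌊A⌋₊ : ℝ) := by have := Nat.lt_floor_add_one A; linarith
      linarith
    linarith
  have hNdiv : (N : ℝ) / Real.log x ^ (K + 1) ≤ (x / A) / Real.log x ^ (K + 1) :=
    div_le_div_of_nonneg_right hNxA hLK1.le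
  have hNdiv0 : 0 ≤ (N : ℝ) / Real.log x ^ (K + 1) := div_nonneg (Nat.cast_nonneg _) hLK1.le
  calc |∑ a ∈ Ioc ⌊A⌋₊ (⌊2 * A⌋₊ - h), blockRow lam c a (a + h) k N|
      ≤ ∑ a ∈ Ioc ⌊A⌋₊ (⌊2 * A⌋₊ - h), |blockRow lam c a (a + h) k N| := abs_sum_le_sum_abs _ _
    _ ≤ ∑ _a ∈ Ioc ⌊A⌋₊ (⌊2 * A⌋₊ - h), (N : ℝ) / Real.log x ^ (K + 1) := sum_le_sum hrow
    _ = ((⌊2 * A⌋₊ - h - ⌊A⌋₊ : ℕ) : ℝ) * ((N : ℝ) / Real.log x ^ (K + 1)) := by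
          rw [sum_const, Nat.card_Ioc, nsmul_eq_mul]
    _ ≤ (2 * A) * ((x / A) / Real.log x ^ (K + 1)) := mul_le_mul hrows hNdiv hNdiv0 (by positivity)
    _ = (2 / Real.log x) * (x / Real.log x ^ K) := by
          rw [Real.rpow_add hlogpos, Real.rpow_one]
          field_simp
    _ ≤ x / Real.log x ^ K := by
          have h21 : 2 / Real.log x ≤ 1 := by rw [div_le_one hlogpos]; exact hlog2
          have hxK : 0 ≤ x / Real.log x ^ K := div_nonneg hxpos.le hLK.le
          calc (2 / Real.log x) * (x / Real.log x ^ K) ≤ 1 * (x / Real.log x ^ K) :=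
                mul_le_mul_of_nonneg_right h21 hxK
            _ = x / Real.log x ^ K := one_mul _

end

end Summit.Parity.GeneralizedHardyLittlewood.Theorems.TableChowla.Negative
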